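import Summits.QuantumFields.YangMills.Theorems.SwapVirialDeficitZeroModeExactCommutatorBall
import HarnessLib

/-!
# Zero-mode EXACT rung Z1-c: the axial mass is UNIFORM on `[0,1]`, and the commutator-square law `‖[q a, q u]‖² ∼ 4‖Im q a‖²·U[0,1]`
# (free-hands support of crux ⟨stmt-QuantumFields-24197⟩ `SwapVirialDeficit.SwapGluedStiffness`; zero-mode exact rung of fcl-p3 g43's plan
# `memo-24197-zero-mode-exact-rung.md` — the integral form behind items Z1/Z3 and the fibre integrals of the Laplace versions Z3-L/Z4-L)

From Archimedes on `S³` (file Z1-a ✓`haar_axialTube_eq_ofReal`: `Haar{(q u)_J² + (q u)_K² ≤ R²} = min 1 R²`) the PUSH-FORWARD of Haar measure under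
the axial mass `m(u) = (q u)_J² + (q u)_K²` is Lebesgue measure on `[0,1]` (two finite measures on `ℝ` with the same distribution function,
✓`Measure.ext_of_Iic`):
* ★★ `map_axialMass_eq`: `Haar.map m = vol|[0,1]`; ★★ `lintegral_haar_axialMass`: `∫ g(m(u)) dHaar(u) = ∫_{[0,1]} g` for every measurable `g ≥ 0`;
* ★★★ `lintegral_haar_comp_commSq`: for EVERY `a ∈ SU(2)` and measurable `g ≥ 0`,
  `∫ g(‖q a·q u − q u·q a‖²) dHaar(u) = ∫_{[0,1]} g(4‖Im q a‖²·s) ds` — the commutator square with a fixed letter is `4‖Im q a‖²` times a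
  UNIFORM variable (straightening + conjugation invariance of the cone measure as in Z1-b; trivially true for central `a`).
File Z3-L uses it with `g = e^{−β·}`: the exact one-letter Laplace transform `(1 − e^{−4β‖Im q a‖²})/(4β‖Im q a‖²)` and the pair limit `β·Λ₂(β) → ½`.

HONEST LABEL: exact finite-dimensional Haar identities (plan-level zero-mode rung of a DRAFT line); NOT the fixed-`L` sharp law, NOT ⟨24197⟩; no rung /
summit statement is proved; the Yang–Mills mass gap is NOT proved; no summit is proved by a line.  Width seat ym-line-sfw-p2-w3 g62 (cell ym-idea-1,
free hands; own crux ⟨22884⟩ blocked-on ⟨19935⟩), `--supports stmt-QuantumFields-24197`.  THEOREMS ONLY, standard axioms, 0 `sorry`.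
References: [cite: Chatterjee2026YMHiggs, Lemma 5.1 / Cor. 5.2]; [folklore] (Archimedes' hat-box theorem).
-/

set_option autoImplicit false

noncomputable section

open MeasureTheory Quaternion Set Real
open scoped Quaternion ENNReal BigOperators
open Literature.MathematicalPhysics.QuantumLattice
open Literature.MathematicalPhysics.QuantumFieldTheory (haarProbability)
open Literature.MathematicalPhysics.QuantumFieldTheory.Balaban1983to89.T4HaarSU2Translate (su2Quat_quatToSU2 measurable_su2Quat
  continuous_su2Quat)
open Summit.QuantumFields.YangMills.Theorems.SwapTwistDeficit.ToronLog
open Summit.QuantumFields.YangMills.Theorems.SwapVirialDeficit.ZeroModeGroup (measurePreserving_conjIso_cone coneMeasure_singleton_zero)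
open Summit.QuantumFields.YangMills.Theorems.ToronValleyVolume.NearlyCommutingCeiling (exists_unit_straighten sq_norm_im_eq)

attribute [local instance] Literature.Analysis.FluidPDE.Tao2016.quatMeasurableSpace
  Literature.Analysis.FluidPDE.Tao2016.quatBorelSpace
  Literature.MathematicalPhysics.QuantumLattice.secondCountableTopology_su2

namespace Summit.QuantumFields.YangMills.Theorems.SwapVirialDeficit.ZeroModeExact

/-! ## §12 The axial mass `m(u) = (q u)_J² + (q u)_K²` is uniformly distributed on `[0,1]` -/

/-- The axial mass is measurable. [folklore] -/
theorem measurable_axialMass :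
    Measurable fun u : Matrix.specialUnitaryGroup (Fin 2) ℂ => (su2Quat u).imJ ^ 2 + (su2Quat u).imK ^ 2 :=
  (((Quaternion.continuous_imJ.comp continuous_su2Quat).pow 2).add ((Quaternion.continuous_imK.comp continuous_su2Quat).pow 2)).measurable

/-- `0 ≤ m(u) ≤ 1`. [folklore] -/
theorem axialMass_mem_Icc (u : Matrix.specialUnitaryGroup (Fin 2) ℂ) :
    (su2Quat u).imJ ^ 2 + (su2Quat u).imK ^ 2 ∈ Icc (0 : ℝ) 1 := by
  have h1 : (su2Quat u).re ^ 2 + (su2Quat u).imI ^ 2 + (su2Quat u).imJ ^ 2 + (su2Quat u).imK ^ 2 = 1 := by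
    have h := norm_su2Quat u
    rw [← Quaternion.normSq_def', Quaternion.normSq_eq_norm_mul_self, h, mul_one]
  exact ⟨by positivity, by nlinarith [sq_nonneg (su2Quat u).re, sq_nonneg (su2Quat u).imI]⟩

/-- Distribution function of the axial mass: `Haar{m ≤ s} = min 1 s` for `s ≥ 0`. [folklore] -/
theorem haar_axialMass_le {s : ℝ} (hs : 0 ≤ s) :
    haarProbability (Matrix.specialUnitaryGroup (Fin 2) ℂ)
        {u : Matrix.specialUnitaryGroup (Fin 2) ℂ | (su2Quat u).imJ ^ 2 + (su2Quat u).imK ^ 2 ≤ s} = ENNReal.ofReal (min 1 s) := by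
  have h := haar_axialTube_eq_ofReal (Real.sqrt_nonneg s)
  rwa [Real.sq_sqrt hs] at h

/-- ★★ **THE AXIAL MASS IS UNIFORM**: the push-forward of Haar measure under `u ↦ (q u)_J² + (q u)_K²` is Lebesgue measure on `[0,1]`. [folklore] -/
theorem map_axialMass_eq :
    (haarProbability (Matrix.specialUnitaryGroup (Fin 2) ℂ)).map
        (fun u : Matrix.specialUnitaryGroup (Fin 2) ℂ => (su2Quat u).imJ ^ 2 + (su2Quat u).imK ^ 2) =
      (volume : Measure ℝ).restrict (Icc 0 1) := by
  haveI : IsFiniteMeasure ((haarProbability (Matrix.specialUnitaryGroup (Fin 2) ℂ)).map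
      (fun u : Matrix.specialUnitaryGroup (Fin 2) ℂ => (su2Quat u).imJ ^ 2 + (su2Quat u).imK ^ 2)) :=
    Measure.isFiniteMeasure_map _ _
  refine Measure.ext_of_Iic _ _ fun a => ?_
  rw [Measure.map_apply measurable_axialMass measurableSet_Iic, Measure.restrict_apply measurableSet_Iic]
  by_cases ha : 0 ≤ a
  · rw [show (fun u : Matrix.specialUnitaryGroup (Fin 2) ℂ => (su2Quat u).imJ ^ 2 + (su2Quat u).imK ^ 2) ⁻¹' Iic a =
        {u | (su2Quat u).imJ ^ 2 + (su2Quat u).imK ^ 2 ≤ a} from rfl, haar_axialMass_le ha]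
    by_cases ha1 : a ≤ 1
    · rw [show Iic a ∩ Icc (0 : ℝ) 1 = Icc 0 a from by
        ext s; simp only [mem_inter_iff, mem_Iic, mem_Icc]; constructor
        · rintro ⟨h1, h2, _⟩; exact ⟨h2, h1⟩
        · rintro ⟨h1, h2⟩; exact ⟨h2, h1, h2.trans ha1⟩, Real.volume_Icc, sub_zero, min_eq_right ha1]
    · push Not at ha1
      rw [show Iic a ∩ Icc (0 : ℝ) 1 = Icc 0 1 from by
        ext s; simp only [mem_inter_iff, mem_Iic, mem_Icc]; constructor
        · rintro ⟨_, h2, h3⟩; exact ⟨h2, h3⟩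
        · rintro ⟨h1, h2⟩; exact ⟨by linarith, h1, h2⟩, Real.volume_Icc, sub_zero, min_eq_left ha1.le]
  · push Not at ha
    have h1 : (fun u : Matrix.specialUnitaryGroup (Fin 2) ℂ => (su2Quat u).imJ ^ 2 + (su2Quat u).imK ^ 2) ⁻¹' Iic a = ∅ := by
      ext u
      simp only [mem_preimage, mem_Iic, mem_empty_iff_false, iff_false, not_le]
      exact ha.trans_le (axialMass_mem_Icc u).1
    have h2 : Iic a ∩ Icc (0 : ℝ) 1 = ∅ := by
      ext s; simp only [mem_inter_iff, mem_Iic, mem_Icc, mem_empty_iff_false, iff_false, not_and, not_le]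
      intro h h0; linarith
    rw [h1, h2, measure_empty, measure_empty]

/-- ★★ **INTEGRALS OF FUNCTIONS OF THE AXIAL MASS**: `∫ g((q u)_J² + (q u)_K²) dHaar(u) = ∫_{[0,1]} g` (`g ≥ 0` measurable). [folklore] -/
theorem lintegral_haar_axialMass (g : ℝ → ℝ≥0∞) (hg : Measurable g) :
    ∫⁻ u, g ((su2Quat u).imJ ^ 2 + (su2Quat u).imK ^ 2) ∂(haarProbability (Matrix.specialUnitaryGroup (Fin 2) ℂ)) =
      ∫⁻ s in Icc (0 : ℝ) 1, g s := by
  rw [← map_axialMass_eq, lintegral_map hg measurable_axialMass]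

/-! ## §13 The commutator-square law: `‖[q a, q u]‖² ∼ 4‖Im q a‖²·U[0,1]` -/

/-- In the cone model (`x ≠ 0`): `‖q a·q(Px) − q(Px)·q a‖² = 4‖Im q a‖²·m(P(c̄ x c))` for a straightening unit `c`. [folklore] -/
theorem commSq_proj_eq {z c : ℍ} (hc : ‖c‖ = 1)
    (hstr : star c * z * c = axisPoint z ∨ star c * z * c = star (axisPoint z)) {x : ℍ} (hx : x ≠ 0) :
    ‖z * su2Quat (quatToSU2 x) - su2Quat (quatToSU2 x) * z‖ ^ 2 =
      4 * ‖z.im‖ ^ 2 * ((su2Quat (quatToSU2 (conjIso c hc x))).imJ ^ 2 + (su2Quat (quatToSU2 (conjIso c hc x))).imK ^ 2) := by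
  have hy0 : conjIso c hc x ≠ 0 := by
    intro h
    have : ‖conjIso c hc x‖ = 0 := by rw [h, norm_zero]
    rw [LinearIsometryEquiv.norm_map] at this
    exact hx (norm_eq_zero.1 this)
  have hxn : ‖x‖ ≠ 0 := norm_ne_zero_iff.2 hx
  rw [tube_coord hy0, LinearIsometryEquiv.norm_map, conjIso_apply, norm_comm_proj hx, mul_pow, norm_comm_sq_straighten hc hstr x]
  field_simp

/-- ★★★ **THE COMMUTATOR-SQUARE LAW**: for every `a ∈ SU(2)` and every measurable `g ≥ 0`,
`∫ g(‖q a·q u − q u·q a‖²) dHaar(u) = ∫_{[0,1]} g(4‖Im q a‖²·s) ds` — with a fixed letter the commutator square is `4‖Im q a‖²` times a uniform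
variable on `[0,1]`. [folklore] -/
theorem lintegral_haar_comp_commSq (a : Matrix.specialUnitaryGroup (Fin 2) ℂ) (g : ℝ → ℝ≥0∞) (hg : Measurable g) :
    ∫⁻ u, g (‖su2Quat a * su2Quat u - su2Quat u * su2Quat a‖ ^ 2) ∂(haarProbability (Matrix.specialUnitaryGroup (Fin 2) ℂ)) =
      ∫⁻ s in Icc (0 : ℝ) 1, g (4 * ‖(su2Quat a).im‖ ^ 2 * s) := by
  set z := su2Quat a with hz
  by_cases him : z.im = 0
  · -- central letter: the commutator vanishes, both sides are `g 0`
    have hcomm : ∀ u : Matrix.specialUnitaryGroup (Fin 2) ℂ, z * su2Quat u - su2Quat u * z = 0 := by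
      intro u
      have hre : z = ((z.re : ℝ) : ℍ) := by
        rw [← Quaternion.re_add_im z, him, add_zero]; simp
      rw [hre, Quaternion.coe_mul_eq_smul, ← Quaternion.coe_mul_eq_smul, sub_eq_zero]
      ext <;> simp [mul_comm]
    simp_rw [hcomm, norm_zero, him, norm_zero]
    simp only [ne_eq, OfNat.ofNat_ne_zero, not_false_eq_true, zero_pow, mul_zero, zero_mul, lintegral_const, measure_univ, mul_one,
      Measure.restrict_apply MeasurableSet.univ, univ_inter, Real.volume_Icc, sub_zero, ENNReal.ofReal_one]
  · obtain ⟨c, hc, hstr⟩ := exists_unit_straighten him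
    -- Haar → cone, conjugate, cone → Haar, then the uniform law of the axial mass
    have hG : Measurable fun u : Matrix.specialUnitaryGroup (Fin 2) ℂ => g (‖z * su2Quat u - su2Quat u * z‖ ^ 2) :=
      hg.comp (((continuous_const.mul continuous_su2Quat).sub (continuous_su2Quat.mul continuous_const)).norm.pow 2).measurable
    have hH : Measurable fun u : Matrix.specialUnitaryGroup (Fin 2) ℂ =>
        g (4 * ‖z.im‖ ^ 2 * ((su2Quat u).imJ ^ 2 + (su2Quat u).imK ^ 2)) := hg.comp (measurable_axialMass.const_mul _)
    rw [← measurePreserving_quatToSU2.lintegral_comp hG]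
    have hae : ∀ᵐ x : ℍ ∂coneMeasure, g (‖z * su2Quat (quatToSU2 x) - su2Quat (quatToSU2 x) * z‖ ^ 2) =
        (fun y : ℍ => g (4 * ‖z.im‖ ^ 2 * ((su2Quat (quatToSU2 y)).imJ ^ 2 + (su2Quat (quatToSU2 y)).imK ^ 2))) (conjIso c hc x) := by
      filter_upwards [ae_ne_zero_cone] with x hx
      rw [commSq_proj_eq hc hstr hx]
    have hH' : Measurable fun y : ℍ =>
        g (4 * ‖z.im‖ ^ 2 * ((su2Quat (quatToSU2 y)).imJ ^ 2 + (su2Quat (quatToSU2 y)).imK ^ 2)) := hH.comp measurable_quatToSU2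
    rw [lintegral_congr_ae hae, (measurePreserving_conjIso_cone c hc).lintegral_comp hH',
      measurePreserving_quatToSU2.lintegral_comp hH]
    exact lintegral_haar_axialMass (fun s => g (4 * ‖z.im‖ ^ 2 * s)) (hg.comp (measurable_const.mul measurable_id))

end Summit.QuantumFields.YangMills.Theorems.SwapVirialDeficit.ZeroModeExact

end
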